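import Summits.BirchSwinnertonDyer.Rank1Residual.ManinAdditive.QuarterShiftTwistUFamily
import Summits.BirchSwinnertonDyer.Rank1Residual.ManinAdditive.MinusOneOrbitManinEqHolds
import Summits.BirchSwinnertonDyer.BirchSwinnertonDyer.Theorems.ManinLocalTwoThreeUFamilyConductorLaw
import Summits.BirchSwinnertonDyer.BirchSwinnertonDyer.Theorems.ManinLocalTwoThreeManinPrimeToAdditiveFiveLeOptimalPartner
import Literature.NumberTheory.EllipticCurves.GlobalMinimalModelProofs
import Literature.NumberTheory.EllipticCurves.CuspFormLFunctionLevelConductorProofs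
import Literature.NumberTheory.EllipticCurves.ModularCurveManinSemistableBridgeProofs
import Literature.NumberTheory.EllipticCurves.IsogenyQuadraticTwistProofs
import Literature.NumberTheory.EllipticCurves.IsogenyDualInseparableProofs
import Literature.NumberTheory.EllipticCurves.SzpiroOfAbcProofs
import HarnessLib

/-!
# The `χ₋₄` PAIRING ROWS of the `u`-family (es g34, MEMO-es §55.5) are THEOREMS modulo modularity — S-es-g34-1
# `UFamilyNegOneTwinAtSixteen`, S-es-g34-1′ `UFamilyNegOneTwinAtFour`, S-es-g34-2 `UFamilyOptimalNegOneTwinAtSixteen` BY NAME from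
# `exists_isNewformOf` alone; hence E-es-163 ⟺ E-es-164, E-es-165 `UFamilyManinTwinAtSixteen`, and «C2 on the `16 ∥ N` `u`-family stratum
# ⟸ C2 on the `4 ∥ N` stratum» (cell `bsd-f2-manin`; crux C2 `ManinOddAtFour`, stmt-BirchSwinnertonDyer-22967; prover p2 gen 19;
# answers es's ask A-es-g34-1 and feeds the LEAD offer L-es-g34-1)

Summit `BirchSwinnertonDyer`, route `ManinLocalTwoThree`, deciding theorem of this line = crux C2
`Summit.BirchSwinnertonDyer.BirchSwinnertonDyer.Theses.ManinLocalTwoThree.ManinOddAtFour` (NOT proved here).  The three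
`@[conjecture]` support rows of the landed `Summits/BirchSwinnertonDyer/Rank1Residual/ManinAdditive/QuarterShiftTwistUFamily.lean`
(typer T-es-61 part 2) are «fact-shaped»: es §55.5 describes their content as «an's `UFamilyConductorLaw` (E-an-149; Tate at `2`)
+ the Modularity Theorem + a global minimal model» (S-1/S-1′) and «+ an's E-an-50♯-type optimality of the `(−u)`-model at `4 ∥ N`»
(S-2).  Here they are DISCHARGED BY NAME from the Modularity Theorem `exists_isNewformOf` (Diamond–Shurman Thm. 8.8.3, a hypothesis of
the crux itself) and TREE THEOREMS only — no optimality law is needed for S-2: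

* §1 algebra: `IsUFamilyCurve` is a `ℚ`-isomorphism invariant (`isUFamilyCurve_smul_iff`); the `χ₋₄`-twist is an involution up to
  `ℚ`-isomorphism (`(W ⊗ (−1)) ⊗ (−1) = W ⊗ 1 ≅ W`, tree `quadraticTwist_quadraticTwist` + `exists_variableChange_quadraticTwist_one`),
  so the pairing `C • (W ⊗ (−1)) = W′` is symmetric (`exists_smul_quadraticTwist_eq_symm`) and transports the family parameter
  `u ↦ −u` (tree `isUFamilyCurve_quadraticTwist_negOne`).
* §2 `exists_minimal_negOne_twin`: granted modularity, `W′ ⊗ (−1)` has a GLOBALLY MINIMAL model `W` (Néron, tree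
  `hasGlobalMinimalModel_rat_holds`) with a modular parametrisation datum at its conductor (tree
  `nonempty_modularParametrizationData_of_isNewformOf`), same conductor (`conductorNorm_smul_rat`).
* §3 S-es-g34-1 (`uFamilyNegOneTwinAtSixteen_of_modularity`) and S-es-g34-1′ (`uFamilyNegOneTwinAtFour_of_modularity`): the conductor
  relations `N(W′) = 4·N(W)` are S-an-64 `UFamilyConductorLaw`, a tree THEOREM (`uFamilyConductorLaw_holds`, p3 g12), read at `W′`
  (`u ≡ 3 (4)`) resp. at the `(−u)`-family curve `W ⊗ (−1)` (`−u ≡ 3 (4)`), whose own twist is `W ⊗ 1 ≅ W`.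
* §4 S-es-g34-2 (`uFamilyOptimalNegOneTwinAtSixteen_of_modularity`): take the LATTICE-OPTIMAL curve `W₀` of the class of `W′ ⊗ (−1)`
  (Edixhoven Prop. 2, tree `exists_isIsogenous_latticeOptimal`); its conductor is that of the class (level = conductor granted modularity,
  tree `IsNewformOf.level_eq_conductorNorm_of_exists_isNewformOf` + `IsNewformOf.of_isIsogenous`), i.e. `N(W′)/4`, so `4 ∣ N(W₀)` and
  es's OPTIMAL RIGIDITY ACROSS LEVELS (`negOneOptimalTwistRigidity_levelRaising`, THEOREM 55.D/E, kernel) gives `W₀ ⊗ (−1) ≅ W′` over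
  `ℚ`; hence `W₀` is a `(−u)`-family curve (§1) and, both curves being additive at `2`, `Δ(W′) = Δ(W₀)` by the Connell–Pal lemma — the
  tree THEOREM `negOneTwistMinimalDiscrEq_holds` (`ManinAdditive/MinusOneOrbitManinEqHolds.lean`; NB: es's §55.8 law E-es-166
  `NegOneTwistDiscrEqOfAdditive` is this theorem with the variable change bound existentially).
* §5 consequences BY NAME through es's kernel glue: `uFamilyCuspidalImageNonzero_four_iff_sixteen_of_modularity` (E-es-163 ⟺ E-es-164:
  the `4 ∥ N` and `16 ∥ N` cusp-image laws of the `u`-family are ONE law), `uFamilyManinTwinAtSixteen_of_modularity` (E-es-165: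
  `|c(E_u, 16p′)| = |c(E_{−u}, 4p′)|` for the optimal pair), `uFamily_maninOdd_sixteen_of_four_of_modularity` (C2 on the `16 ∥ N`
  `u`-family stratum ⟸ C2 on the `4 ∥ N` `u`-family stratum).

HONEST FRAMING.  CONDITIONAL bookkeeping: every statement carries the Modularity Theorem `exists_isNewformOf` as a hypothesis (the
audit records `proof.conditional`; inside the crux `ManinOddAtFour` that hypothesis is available by name).  The LAWS E-es-163/164
(cusp image non-zero on the `u`-family) remain OPEN; nothing here proves Manin's conjecture, `ManinOddAtFour`, or BSD.  No `sorry`,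
no new definition, no named fact; standard axioms.
References: [BCDTJAMS2001] Thm. A; [DiamondShurman2005] Thm. 8.8.3; [EdixhovenManin1991] Prop. 2; [Pal2012] Prop. 2.4;
[SilvermanAEC2009] VIII.8.3, X.5.4.
-/

set_option linter.dupNamespace false
set_option autoImplicit false

noncomputable section

open scoped MatrixGroups ModularForm

open CongruenceSubgroup WeierstrassCurve
  Literature.NumberTheory.DiophantineGeometry
  Literature.NumberTheory.EllipticCurves
  Literature.NumberTheory.EllipticCurves.ModularForms
  Literature.NumberTheory.Automorphic
  Summit.BirchSwinnertonDyer.Rank1Residual.ManinAdditive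

namespace Summit.BirchSwinnertonDyer.BirchSwinnertonDyer.Theorems.ManinLocalTwoThree.UFamilyTwin

/-! ## §1 Algebra of `u`-family curves under changes of variables and the `χ₋₄` involution -/

/-- `IsUFamilyCurve` is invariant under `ℚ`-isomorphisms: `C • W` is a `u`-family curve iff `W` is. [folklore] -/
theorem isUFamilyCurve_smul_iff (W : WeierstrassCurve ℚ) (C : VariableChange ℚ) (u : ℤ) :
    IsUFamilyCurve (C • W) u ↔ IsUFamilyCurve W u := by
  constructor
  · rintro ⟨C₀, s, h⟩
    exact ⟨C₀ * C, s, by simpa only [mul_smul] using h⟩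
  · rintro ⟨C₀, s, h⟩
    exact ⟨C₀ * C⁻¹, s, by simpa only [mul_smul, inv_smul_smul] using h⟩

/-- The `χ₋₄`-twist is an involution up to `ℚ`-isomorphism: `(W ⊗ (−1)) ⊗ (−1) = W ⊗ 1 = C • W`. [folklore] -/
theorem exists_smul_eq_quadraticTwist_negOne_quadraticTwist_negOne (W : WeierstrassCurve ℚ) :
    ∃ C : VariableChange ℚ,
      C • W = (W.quadraticTwist ((-1 : ℤ) : ℚ)).quadraticTwist ((-1 : ℤ) : ℚ) := by
  rw [quadraticTwist_quadraticTwist, show ((-1 : ℤ) : ℚ) * ((-1 : ℤ) : ℚ) = 1 by norm_num]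
  exact exists_variableChange_quadraticTwist_one W

/-- If `C • (W ⊗ (−1)) = W'` and `W'` is a `u`-family curve then `W` is a `(−u)`-family curve
(`W ≅ W ⊗ 1 = (W ⊗ (−1)) ⊗ (−1) ≅ W' ⊗ (−1)`). [folklore] -/
theorem isUFamilyCurve_neg_of_smul_quadraticTwist_eq {W W' : WeierstrassCurve ℚ} {u : ℤ} {C : VariableChange ℚ}
    (hU : IsUFamilyCurve W' u) (hC : C • W.quadraticTwist ((-1 : ℤ) : ℚ) = W') : IsUFamilyCurve W (-u) := by
  obtain ⟨C₁, hC₁⟩ := exists_smul_eq_quadraticTwist_negOne_quadraticTwist_negOne W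
  have h1 : IsUFamilyCurve (W'.quadraticTwist ((-1 : ℤ) : ℚ)) (-u) := isUFamilyCurve_quadraticTwist_negOne hU
  rw [← hC, quadraticTwist_smul, isUFamilyCurve_smul_iff, ← hC₁, isUFamilyCurve_smul_iff] at h1
  exact h1

/-- If `C • (W ⊗ (−1)) = W'` then `C' • (W' ⊗ (−1)) = W` for some `C'` (the pairing is symmetric). [folklore] -/
theorem exists_smul_quadraticTwist_eq_symm {W W' : WeierstrassCurve ℚ} {C : VariableChange ℚ}
    (hC : C • W.quadraticTwist ((-1 : ℤ) : ℚ) = W') :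
    ∃ C' : VariableChange ℚ, C' • W'.quadraticTwist ((-1 : ℤ) : ℚ) = W := by
  obtain ⟨C₁, hC₁⟩ := exists_smul_eq_quadraticTwist_negOne_quadraticTwist_negOne W
  rw [← hC, quadraticTwist_smul, ← hC₁, smul_smul]
  exact ⟨(⟨C.u, ((-1 : ℤ) : ℚ) * C.r, 0, 0⟩ * C₁)⁻¹, inv_smul_smul _ _⟩


/-! ## §2 The globally minimal `χ₋₄`-twin of a `u`-family curve (with its modular datum, granted modularity) -/

/-- **The minimal modular `χ₋₄`-twin.** Granted modularity (`exists_isNewformOf`), every elliptic `u`-family curve `W'` has a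
GLOBALLY MINIMAL `(−u)`-family curve `W`, `ℚ`-isomorphic to `W' ⊗ (−1)` (so `W ⊗ (−1) ≅ W'` as well), carrying a modular
parametrisation datum at its conductor (Néron VIII.8.3 + BCDT). [cite: BCDTJAMS2001, Thm. A] -/
theorem exists_minimal_negOne_twin (hnf : exists_isNewformOf) (W' : WeierstrassCurve ℚ) [W'.IsElliptic] (u : ℤ)
    (hU : IsUFamilyCurve W' u) :
    ∃ (W : WeierstrassCurve ℚ) (_ : W.IsElliptic) (_ : W.IsGloballyMinimal) (_ : NeZero (W.conductorNorm ℤ))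
      (_ : ModularParametrizationData W (W.conductorNorm ℤ)) (C : VariableChange ℚ),
      IsUFamilyCurve W (-u) ∧ C • W'.quadraticTwist ((-1 : ℤ) : ℚ) = W ∧
      (haveI := W'.isElliptic_quadraticTwist (show ((-1 : ℤ) : ℚ) ≠ 0 by norm_num);
        (W'.quadraticTwist ((-1 : ℤ) : ℚ)).conductorNorm ℤ) = W.conductorNorm ℤ := by
  have hd : ((-1 : ℤ) : ℚ) ≠ 0 := by norm_num
  haveI hT := W'.isElliptic_quadraticTwist hd
  obtain ⟨C, hmin⟩ := hasGlobalMinimalModel_rat_holds (W'.quadraticTwist ((-1 : ℤ) : ℚ))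
  haveI := hmin
  haveI : NeZero ((C • W'.quadraticTwist ((-1 : ℤ) : ℚ)).conductorNorm ℤ) :=
    ⟨(conductorNorm_pos_holds (C • W'.quadraticTwist ((-1 : ℤ) : ℚ))).ne'⟩
  obtain ⟨f, hf⟩ := hnf (C • W'.quadraticTwist ((-1 : ℤ) : ℚ))
  obtain ⟨D⟩ := nonempty_modularParametrizationData_of_isNewformOf hf
  exact ⟨C • W'.quadraticTwist ((-1 : ℤ) : ℚ), inferInstance, hmin, inferInstance, D, C,
    (isUFamilyCurve_smul_iff _ C (-u)).mpr (isUFamilyCurve_quadraticTwist_negOne hU), rfl,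
    (conductorNorm_smul_rat (W'.quadraticTwist ((-1 : ℤ) : ℚ)) C).symm⟩

/-! ## §3 The fact-shaped pairing rows S-es-g34-1 / S-es-g34-1′ BY NAME, modulo modularity only -/

/-- **S-es-g34-1 `UFamilyNegOneTwinAtSixteen` HOLDS granted modularity**: a `u`-family curve `W′` with `u ≡ 3 (mod 4)` and
`16 ∥ N(W′)` has a modular, globally minimal `χ₋₄`-partner `W` (a `(−u)`-family curve) at conductor `N(W′)/4`.  Content =
S-an-64 `UFamilyConductorLaw` (tree THEOREM `uFamilyConductorLaw_holds`) + a global minimal model of `W′ ⊗ (−1)` + a datum from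
`exists_isNewformOf`.  (The hypotheses `16 ∥ N(W′)` are not even needed.) [cite: BCDTJAMS2001, Thm. A] -/
theorem uFamilyNegOneTwinAtSixteen_of_modularity (hnf : exists_isNewformOf) : UFamilyNegOneTwinAtSixteen := by
  intro W' _ u hU hu3 _ _
  obtain ⟨W, hE, hmin, hN0, D, C, hUW, hC, hNT⟩ := exists_minimal_negOne_twin hnf W' u hU
  have hlaw := (uFamilyConductorLaw_holds W' u hU).2 hu3
  obtain ⟨C', hC'⟩ := exists_smul_quadraticTwist_eq_symm hC
  refine ⟨W, hE, hmin, hN0, D, hUW, ?_, isIsogenous_of_smul_eq hC'⟩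
  rw [← hlaw, ← hNT]

/-- **S-es-g34-1′ `UFamilyNegOneTwinAtFour` HOLDS granted modularity**: a `u`-family curve `W` with `u ≡ 1 (mod 4)` has `4 ∥ N(W)`
(S-an-64) and a modular, globally minimal `χ₋₄`-partner `W′` (a `(−u)`-family curve, the minimal model of `W ⊗ (−1)`) at conductor
`4·N(W)` (S-an-64 read at the `(−u)`-family curve `W ⊗ (−1)`, whose own `χ₋₄`-twist is `W ⊗ 1 ≅ W`). [cite: BCDTJAMS2001, Thm. A] -/
theorem uFamilyNegOneTwinAtFour_of_modularity (hnf : exists_isNewformOf) : UFamilyNegOneTwinAtFour := by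
  intro W _ u hU hu1
  have hd : ((-1 : ℤ) : ℚ) ≠ 0 := by norm_num
  have h4 := (uFamilyConductorLaw_holds W u hU).1 hu1
  refine ⟨h4.1, h4.2, ?_⟩
  -- the `(−u)`-family curve `T = W ⊗ (−1)` and its minimal model
  haveI hT := W.isElliptic_quadraticTwist hd
  have hUT : IsUFamilyCurve (W.quadraticTwist ((-1 : ℤ) : ℚ)) (-u) := isUFamilyCurve_quadraticTwist_negOne hU
  have hu3 : (-u) % 4 = 3 := by omega
  -- S-an-64 at `T`: `4 · N(T ⊗ (−1)) = N(T)`, and `T ⊗ (−1) ≅ W`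
  have hlawT := (uFamilyConductorLaw_holds (W.quadraticTwist ((-1 : ℤ) : ℚ)) (-u) hUT).2 hu3
  haveI hTT := (W.quadraticTwist ((-1 : ℤ) : ℚ)).isElliptic_quadraticTwist hd
  obtain ⟨C₁, hC₁⟩ := exists_smul_eq_quadraticTwist_negOne_quadraticTwist_negOne W
  have hNTT : ∀ (X : WeierstrassCurve ℚ) [X.IsElliptic], C₁ • W = X → X.conductorNorm ℤ = W.conductorNorm ℤ := by
    rintro X _ rfl
    exact conductorNorm_smul_rat W C₁
  have hNW : ((W.quadraticTwist ((-1 : ℤ) : ℚ)).quadraticTwist ((-1 : ℤ) : ℚ)).conductorNorm ℤ = W.conductorNorm ℤ :=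
    hNTT _ hC₁
  -- the minimal model of `T` with its datum
  obtain ⟨C, hmin⟩ := hasGlobalMinimalModel_rat_holds (W.quadraticTwist ((-1 : ℤ) : ℚ))
  haveI := hmin
  haveI : NeZero ((C • W.quadraticTwist ((-1 : ℤ) : ℚ)).conductorNorm ℤ) :=
    ⟨(conductorNorm_pos_holds (C • W.quadraticTwist ((-1 : ℤ) : ℚ))).ne'⟩
  obtain ⟨f, hf⟩ := hnf (C • W.quadraticTwist ((-1 : ℤ) : ℚ))
  obtain ⟨D⟩ := nonempty_modularParametrizationData_of_isNewformOf hf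
  refine ⟨C • W.quadraticTwist ((-1 : ℤ) : ℚ), inferInstance, hmin, inferInstance, D,
    (isUFamilyCurve_smul_iff _ C (-u)).mpr hUT, ?_, isIsogenous_smul _ C⟩
  rw [conductorNorm_smul_rat, ← hlawT, hNW]

/-! ## §4 S-es-g34-2 BY NAME (optimality AND equal discriminants), modulo modularity only -/

/-- **S-es-g34-2 `UFamilyOptimalNegOneTwinAtSixteen` HOLDS granted modularity.**  For the `X₀`-optimal (lattice-optimal, globally
minimal) curve `W′` of a `16 ∥ N` `u`-family class (`u ≡ 3 (4)`): the lattice-optimal curve `W₀` of the class of `W′ ⊗ (−1)`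
(Edixhoven, tree `exists_isIsogenous_latticeOptimal`) sits at level `N(W′)/4` (S-an-64 + conductor = level granted modularity,
`IsNewformOf.level_eq_conductorNorm_of_exists_isNewformOf`), so es's OPTIMAL RIGIDITY ACROSS LEVELS
(`negOneOptimalTwistRigidity_levelRaising`, THEOREM 55.D/E) makes `W₀ ⊗ (−1) ≅ W′` over `ℚ`; hence `W₀` is a `(−u)`-family curve and,
both curves being additive at `2`, `Δ(W′) = Δ(W₀)` by the Connell–Pal lemma (tree THEOREM `negOneTwistMinimalDiscrEq_holds`).
[cite: EdixhovenManin1991, Prop. 2] [cite: Pal2012, Prop. 2.4 (2)(b)(iii)] -/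
theorem uFamilyOptimalNegOneTwinAtSixteen_of_modularity (hnf : exists_isNewformOf) :
    UFamilyOptimalNegOneTwinAtSixteen := by
  intro W' _ _ _ D' u hD' hU hu3 h16 h32
  have hd : ((-1 : ℤ) : ℚ) ≠ 0 := by norm_num
  -- the minimal twin `W₁ ≅ W' ⊗ (−1)` and the conductor relation `N(W') = 4 N(W₁)`
  obtain ⟨W₁, hE₁, hmin₁, hN₁, D₁, C, hUW₁, hC, hNT⟩ := exists_minimal_negOne_twin hnf W' u hU
  have hlaw := (uFamilyConductorLaw_holds W' u hU).2 hu3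
  have hN'W₁ : W'.conductorNorm ℤ = 4 * W₁.conductorNorm ℤ := by rw [← hlaw, ← hNT]
  -- the lattice-optimal curve `W₀` of the class of `W₁`, at the same conductor
  obtain ⟨W₀, hE₀, hmin₀, hN₀, D₀, hD₀, hiso⟩ := exists_isIsogenous_latticeOptimal hnf W₁
  have hlev : W₀.conductorNorm ℤ = W₁.conductorNorm ℤ :=
    IsNewformOf.level_eq_conductorNorm_of_exists_isNewformOf hnf (D₀.isNewformOf.of_isIsogenous hiso)
  have hN' : W'.conductorNorm ℤ = 4 * W₀.conductorNorm ℤ := by rw [hlev, hN'W₁]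
  have h4 : 4 ∣ W₀.conductorNorm ℤ := by
    have h16' : 2 ^ 4 ∣ 4 * W₀.conductorNorm ℤ := hN' ▸ h16
    obtain ⟨k, hk⟩ := h16'
    exact ⟨k, by omega⟩
  have h4W₀ : 2 ^ 2 ∣ W₀.conductorNorm ℤ := by simpa using h4
  have h4W' : 2 ^ 2 ∣ W'.conductorNorm ℤ := dvd_trans ⟨4, by norm_num⟩ h16
  -- `W₀ ⊗ (−1) ~ W₁ ⊗ (−1) ≅ W'`
  obtain ⟨C', hC'⟩ := exists_smul_quadraticTwist_eq_symm hC
  haveI := W₀.isElliptic_quadraticTwist hd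
  haveI := W₁.isElliptic_quadraticTwist hd
  have hisoTw : IsIsogenous (W₀.quadraticTwist ((-1 : ℤ) : ℚ)) W' :=
    ((hiso.symm_of_isElliptic).quadraticTwist hd).trans' (isIsogenous_of_smul_eq hC')
  -- optimal rigidity across levels: `W₀ ⊗ (−1) ≅ W'`
  obtain ⟨uC, huC⟩ := negOneOptimalTwistRigidity_levelRaising D₀ D' hD₀ hD' hN' h4 h4W₀ h4W' hisoTw
  refine ⟨W₀, hE₀, hmin₀, hN₀, D₀, hD₀, isUFamilyCurve_neg_of_smul_quadraticTwist_eq hU huC, hN', hisoTw, ?_⟩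
  exact negOneTwistMinimalDiscrEq_holds W₀ W' uC h4W₀ h4W' huC

/-! ## §5 Consequences BY NAME: E-es-163 ⟺ E-es-164, E-es-165, and C2 on the `u`-family across `4 ∥ N → 16 ∥ N` -/

/-- **E-es-163 ⟺ E-es-164 granted modularity**: the `4 ∥ N` and the `16 ∥ N` cusp-image laws of the `u`-family are ONE
statement (es's THEOREM 55.A glue `uFamilyCuspidalImageNonzero_four_iff_sixteen` fed with §3). -/
theorem uFamilyCuspidalImageNonzero_four_iff_sixteen_of_modularity (hnf : exists_isNewformOf) :
    UFamilyCuspidalImageNonzeroAtConductorFour ↔ UFamilyCuspidalImageNonzeroAtConductorSixteen :=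
  uFamilyCuspidalImageNonzero_four_iff_sixteen (uFamilyNegOneTwinAtSixteen_of_modularity hnf)
    (uFamilyNegOneTwinAtFour_of_modularity hnf)

/-- **E-es-165 `UFamilyManinTwinAtSixteen` HOLDS granted modularity**: the Manin constant of the `X₀`-optimal `16 ∥ N`
`u`-family curve equals, up to sign, that of a lattice-optimal `(−u)`-family curve at `N/4` (es's THEOREM 55.F glue + §4). -/
theorem uFamilyManinTwinAtSixteen_of_modularity (hnf : exists_isNewformOf) : UFamilyManinTwinAtSixteen :=
  uFamilyManinTwinAtSixteen_of (uFamilyOptimalNegOneTwinAtSixteen_of_modularity hnf)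

/-- **C2 on the `16 ∥ N` `u`-family stratum ⟸ C2 on the `4 ∥ N` `u`-family stratum, granted modularity** (es's
`uFamily_maninOdd_sixteen_of_four` + §4): if every lattice-optimal `u`-family datum with `u ≡ 1 (4)` has odd Manin constant, so does
every lattice-optimal `u`-family datum with `u ≡ 3 (4)` and `16 ∥ N`.  CONDITIONAL bookkeeping; Manin's conjecture is not proved. -/
theorem uFamily_maninOdd_sixteen_of_four_of_modularity (hnf : exists_isNewformOf)
    (hodd : ∀ (W : WeierstrassCurve ℚ) [W.IsElliptic] [W.IsGloballyMinimal] [NeZero (W.conductorNorm ℤ)]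
      (D : ModularParametrizationData W (W.conductorNorm ℤ)) (u : ℤ),
      IsLatticeOptimal D → IsUFamilyCurve W u → u % 4 = 1 → ¬ 2 ∣ D.c) :
    ∀ (W' : WeierstrassCurve ℚ) [W'.IsElliptic] [W'.IsGloballyMinimal] [NeZero (W'.conductorNorm ℤ)]
      (D' : ModularParametrizationData W' (W'.conductorNorm ℤ)) (u : ℤ),
      IsLatticeOptimal D' → IsUFamilyCurve W' u → u % 4 = 3 → 2 ^ 4 ∣ W'.conductorNorm ℤ →
      ¬ 2 ^ 5 ∣ W'.conductorNorm ℤ → ¬ 2 ∣ D'.c :=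
  uFamily_maninOdd_sixteen_of_four (uFamilyOptimalNegOneTwinAtSixteen_of_modularity hnf) hodd

end Summit.BirchSwinnertonDyer.BirchSwinnertonDyer.Theorems.ManinLocalTwoThree.UFamilyTwin

end
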